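import Literature.NumberTheory.GaloisRepresentations.LocalDualityTwoZeroEigenBoundProofs
import HarnessLib

/-!
# `#H²(F, L) ≤ #(S ⧸ (π^n))` for a cyclic `S`-line `L` on which one Galois element acts by a scalar `μ` with
# `(μ − c)·ν ≡ π^n` (theorems only — no definition, no named fact, no instance, no `sorry`)

Topic `NumberTheory/GaloisRepresentations` (sequel of `LocalDualityTwoZeroEigenBoundProofs`: `#H²(F, V) ≤ #(V ⧸ R)` for
`R ≤ (g₀ − c)·V`).  Brick (F4c-2) of the uniform-`ι` road of cell `pub/bsd-print-x9` (stub `stub_h5bAtS`; design x9-p1-w3 g6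
2026-08-28T21:10:46Z: «H² exponents by COUNT … `g₀` acts on `Fil_w / gr_w` by scalars»): the two LINES of the `π`-adic
Eisenstein levels at `w ∣ p` — the plus part `Fil_w(T/π^iT) = (A_{m,k} ⊗ Fil_w E[p^k])/π^i` and the graded piece
`gr_w(T/π^iT)` — are CYCLIC modules over Howard's DVR `S_𝔮 = Λ/(T^m + p)` on which an element `g₀ ∈ Γ_{K_w}` with
`κ(g₀) = p^s` acts by a SCALAR `μ = λ·(1+T)^{p^s}` (`λ ∈ ℤ` the scalar of `g₀` on the cyclic group `Fil_w E[p^k]`, resp.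
`gr_w E[p^k]`), while `g₀` acts on `μ_{p^k}` by an integer `c`; and `μ − c` is a unit times `T^a`, `a ≤ p^s`.  Abstractly:

* `natCard_two_le_natCard_quotient_span_of_cyclic_scalar` — for a finite discrete `Γ_F`-module `X` killed by `p^k` which is a
  CYCLIC module `X = S·x₀` over a commutative ring `S` acting compatibly, an element `g₀` acting on `X` as the scalar `μ ∈ S`
  and on `μ_{p^k}(F̄)` as the integer `c`, and scalars `ν, π^n` with `(μ − c)·ν·x = π^n·x` on `X`:
  **`#H²(F, X) ≤ #(S ⧸ (π^n))`** (with `Finite (H²(F, X))`) — `π^n·X ≤ (g₀ − c)·X`, so by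
  `natCard_two_le_natCard_quotient_of_mu_apply_eq_smul` `#H² ≤ #(X ⧸ π^n·X)`, and `c ↦ c·x₀` induces `S ⧸ (π^n) ↠ X ⧸ π^n·X`.

With `S = S_𝔮`, `π = T mod 𝔮`, `n = p^s < m` the right side is `p^{p^s}` (tree `natCard_quotient_span_mk_X_pow_eq`), uniformly
in the level — the H²-exponent input of the torsion-cut readout of Howard's `F_𝔮` at `w ∣ p`.  No summit statement is proved;
BSD is not proved by any of this.

References: [MilneADT2006] I Cor. 2.3, Prop. 0.19; [Howard2004HeegnerKolyvagin] Lemma 3.2.7 (arXiv:1202.6340 p. 16 L150–156),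
§3.1 (`Fil_v`, `gr_v`), proof of Thm. 2.2.10 (`S_𝔮` a DVR, `π^m = −p`); [SerreGaloisCohomology1997] II §5.2 Thm. 2.
-/

set_option autoImplicit false

noncomputable section

open Function Field

universe u v

namespace Literature.NumberTheory.GaloisRepresentations

open DiscreteGaloisModule ContinuousRep

section Local

variable (F : Type u) [Field F] [ValuativeRel F] [TopologicalSpace F] [IsNonarchimedeanLocalField F] [CharZero F]
variable {X : Type u} [AddCommGroup X] [TopologicalSpace X] [DiscreteTopology X] [Finite X]
variable {S : Type v} [CommRing S] [Module S X]

/-- **`#H²(F, X) ≤ #(S ⧸ (π^n))` for a cyclic `S`-line with a scalar Galois element.**  `X` a finite discrete `Γ_F`-module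
killed by `p^k` (`F` non-archimedean local of characteristic `0`), cyclic over `S` (`X = S·x₀`); `g₀ ∈ Γ_F` acting on `X` as the
scalar `μ ∈ S` and on `μ_{p^k}(F̄)` as the integer `c`; `ν ∈ S`, `π^n` with `(μ − c)·(ν·x) = π^n·x` for all `x`.  Then `H²(F, X)`
is finite and `#H²(F, X) ≤ #(S ⧸ (π^n))`: `π^n·X ≤ (g₀ − c)·X` and `c ↦ c·x₀` maps `S ⧸ (π^n)` ONTO `X ⧸ π^n·X`.
[cite: MilneADT2006, Ch. I Cor. 2.3 and Prop. 0.19] [cite: Howard2004HeegnerKolyvagin, Lemma 3.2.7 (arXiv:1202.6340 p. 16 L150–156)] -/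
theorem natCard_two_le_natCard_quotient_span_of_cyclic_scalar {p k : ℕ} [hp : Fact p.Prime]
    (τ : ContinuousRep (absoluteGaloisGroup F) ℤ X) (hM : ∀ x : X, p ^ k • x = 0)
    (x₀ : X) (hcyc : ∀ x : X, ∃ a : S, a • x₀ = x)
    (g₀ : absoluteGaloisGroup F) (μ : S) (hμ : ∀ x : X, τ g₀ x = μ • x)
    (c : ℤ) (hc : ∀ ζ : MuCarrier F (p ^ k), mu F (p ^ k) g₀ ζ = c • ζ)
    (ν π : S) (n : ℕ) (hν : ∀ x : X, (μ - (c : S)) • (ν • x) = π ^ n • x)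
    [Finite (S ⧸ Ideal.span {π ^ n})] :
    Finite (continuousCohomology 2 τ.toTopRep) ∧
      Nat.card (continuousCohomology 2 τ.toTopRep) ≤ Nat.card (S ⧸ Ideal.span {π ^ n}) := by
  classical
  -- `R = π^n · X`
  let R : AddSubgroup X := (DistribSMul.toAddMonoidHom X (π ^ n)).range
  have hR : ∀ r ∈ R, ∃ x : X, τ g₀ x - c • x = r := by
    rintro _ ⟨x, rfl⟩
    refine ⟨ν • x, ?_⟩
    change τ g₀ (ν • x) - c • (ν • x) = π ^ n • x
    rw [hμ, ← hν x, sub_smul, Int.cast_smul_eq_zsmul]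
  obtain ⟨hfin, hle⟩ := natCard_two_le_natCard_quotient_of_mu_apply_eq_smul F τ hM g₀ c hc R hR
  refine ⟨hfin, hle.trans ?_⟩
  -- `a ↦ a • x₀` induces `S ⧸ (π^n) ↠ X ⧸ R`
  let q : S →+ X := (LinearMap.toSpanSingleton S X x₀).toAddMonoidHom
  have hq : ∀ a : S, q a = a • x₀ := fun _ ↦ rfl
  have hI : (Ideal.span {π ^ n}).toAddSubgroup ≤ R.comap q := by
    intro a ha
    obtain ⟨b, rfl⟩ := Ideal.mem_span_singleton'.mp ha
    rw [AddSubgroup.mem_comap, hq, mul_comm, mul_smul]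
    exact ⟨b • x₀, rfl⟩
  let qbar : S ⧸ (Ideal.span {π ^ n}).toAddSubgroup →+ X ⧸ R := QuotientAddGroup.map _ R q hI
  have hqbar : Surjective qbar := by
    intro y
    induction y using QuotientAddGroup.induction_on with
    | H x =>
      obtain ⟨a, rfl⟩ := hcyc x
      exact ⟨QuotientAddGroup.mk a, by rw [QuotientAddGroup.map_mk, hq]⟩
  have hfinS : Finite (S ⧸ (Ideal.span {π ^ n}).toAddSubgroup) := ‹Finite (S ⧸ Ideal.span {π ^ n})›
  calc Nat.card (X ⧸ R) ≤ Nat.card (S ⧸ (Ideal.span {π ^ n}).toAddSubgroup) := Nat.card_le_card_of_surjective qbar hqbar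
    _ = Nat.card (S ⧸ Ideal.span {π ^ n}) := rfl

end Local

end Literature.NumberTheory.GaloisRepresentations
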